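import Mathlib
import HarnessLib
import Summits.HubbardSuperconductivity.HubbardSuperconductivity.Theorems.KLProgrammeKLRegimeEngineV8DefsG6Q6
import Summits.HubbardSuperconductivity.HubbardSuperconductivity.Theorems.KLProgrammeKLRegimeEngineV8DefsG5ReadingForward
import Summits.HubbardSuperconductivity.HubbardSuperconductivity.Theorems.KLProgrammeKLRegimeEngineV8DefsG5ReadingTwoShell
import Summits.HubbardSuperconductivity.HubbardSuperconductivity.Theorems.KLProgrammeKLRegimeEngineThermalBand

/-!
# K3 ENGINE package v6 (`klEngGeo6`, `klEngQ6`, p524309): the VALUE-LANE READING LEMMAS re-keyed at `klEngGeo6` — token list for the engine-flow /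
# v5 registrant (plan g16 (R25)(c)(v) door-lift census, row (2) of k3c2-p2 g7; K3-FLOW RULING F (5)(S4)(a)/(S6))
# (cell gate-hubbard-kl, seat hubbard-kl-k3c2-p2 g7)

`GeoConsts.raiseTwoLeg` touches only `S`, `SL`: `klEngGeo6.phGain/ppGain/CF/cE4 = klEngGeo5.…` by `rfl` (`klEngGeo6_phGain`, …).  Hence every `klg5_*`
reading lemma of …DefsG5Reading / …G5ReadingForward / …G5ReadingTwoShell and the band door of …EngineThermalBand holds VERBATIM at `klEngGeo6`;
this file states the twins under the names the takers will type (`klg6_*`), each a definitional re-key (no new mathematics):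
`klg6_phGain_reading` (`klg5_phGain_reading_below` is package-free — use it as is), `klg6_phGain_eq_of_le_twelve`, `klg6_phGain_reading_of_le_twelve`, `klg6_ppGain_reading`,
`klg6_ppGain_eq_of_le`, `klg6_gainBar_eq_of_le_twelve`, `klg6_gainBar_ge_of_le`, `klg6_thermal_reading(')`, `klg6_below_add_thermal_of_forward`,
(`klg5_above_of_twoShell` is package-free — use it as is), `klg6_band_le_thermalBar`, `klg6_band_stepValues_of_signBlind` (stub (c)'s five value conjuncts in
the band at `(klEngGeo6, Q)`).

Bookkeeping only; nothing about the model is asserted; nothing asserts superconductivity.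
-/

noncomputable section

namespace Summit.HubbardSuperconductivity.HubbardSuperconductivity.Theorems.EngineV8

set_option linter.dupNamespace false -- summit = problem name (single-conjunct summit), D-0017

open Real Finset Literature.MathematicalPhysics.QuantumLattice Literature.Probability.LatticeModels
open Summit.HubbardSuperconductivity.HubbardSuperconductivity.Theorems.KLRegimeSplit
open Summit.HubbardSuperconductivity.HubbardSuperconductivity.Theorems.KLProgrammeLegKernels

/-! ## §1 Field identities -/

/-- `thermalBar klEngGeo6 = thermalBar klEngGeo5` (reads `CF` only). -/
theorem klg6_thermalBar_eq (P : SplitConsts) (U β : ℝ) (n : ℕ) : thermalBar klEngGeo6 P U β n = thermalBar klEngGeo5 P U β n := rfl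

/-- `gainBar klEngGeo6 = gainBar klEngGeo5` (reads the gains only). -/
theorem klg6_gainBar_eq (P : SplitConsts) (U : ℝ) (n : ℕ) (ρpp ρd ρx : ℝ) :
    gainBar klEngGeo6 P U n ρpp ρd ρx = gainBar klEngGeo5 P U n ρpp ρd ρx := rfl

/-- `2^80 ≤ klEngGeo6.CF`. -/
theorem two_pow_le_klEngGeo6_CF : (2 : ℝ) ^ 80 ≤ klEngGeo6.CF := two_pow_le_klEngGeo5_CF

/-! ## §2 The particle–hole / particle–particle gains at `klEngGeo6` -/

/-- **Reading lemma for the (X) line at `klEngGeo6`** (= `klg5_phGain_reading`). -/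
theorem klg6_phGain_reading {P : SplitConsts} {U ρ b T : ℝ} {n : ℕ} (hρ : 0 ≤ ρ)
    (h1 : b ≤ (P.Klam * U) ^ 2 * 2 ^ 28 + T)
    (h2 : b ≤ (P.Klam * U) ^ 2 * 2 ^ 28 * (2 ^ 24 * ((4 : ℝ) ^ n)⁻¹ + 2 ^ 24 * ρ / klE0 * (4 : ℝ) ^ n) + T)
    (h3 : 0 < ρ → b ≤ (P.Klam * U) ^ 2 * 2 ^ 28 * (2 ^ 24 * (klE0 * ((4 : ℝ) ^ n)⁻¹) / ρ + 2 ^ 24 * Real.sqrt klE0 * ((2 : ℝ) ^ n)⁻¹) + T) :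
    b ≤ (P.Klam * U) ^ 2 * klEngGeo6.phGain n ρ + T :=
  klg5_phGain_reading hρ h1 h2 h3

/-- `klEngGeo6.phGain n ρ = 2^28` for `n ≤ 12`. -/
theorem klg6_phGain_eq_of_le_twelve {n : ℕ} (hn : n ≤ 12) (ρ : ℝ) : klEngGeo6.phGain n ρ = 2 ^ 28 := klg5_phGain_eq_of_le_twelve hn ρ

/-- The sign-blind booking at `n ≤ 12`, package `klEngGeo6`. -/
theorem klg6_phGain_reading_of_le_twelve {P : SplitConsts} {U b T : ℝ} {n : ℕ} (hn : n ≤ 12) (ρ : ℝ)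
    (h1 : b ≤ (P.Klam * U) ^ 2 * 2 ^ 28 + T) : b ≤ (P.Klam * U) ^ 2 * klEngGeo6.phGain n ρ + T :=
  klg5_phGain_reading_of_le_twelve hn ρ h1

/-- **Reading lemma for the pp gain at `klEngGeo6`** (= `klg5_ppGain_reading`). -/
theorem klg6_ppGain_reading {P : SplitConsts} {U ρ b T : ℝ} {n : ℕ}
    (h1 : b ≤ (P.Klam * U) ^ 2 * 2 ^ 28 + T)
    (h3 : 0 < ρ → b ≤ (P.Klam * U) ^ 2 * 2 ^ 28 * (2 ^ 24 * (klE0 * ((4 : ℝ) ^ n)⁻¹) / ρ + 2 ^ 24 * Real.sqrt klE0 * ((2 : ℝ) ^ n)⁻¹) + T) :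
    b ≤ (P.Klam * U) ^ 2 * klEngGeo6.ppGain n ρ + T :=
  klg5_ppGain_reading h1 h3

/-- `klEngGeo6.ppGain n ρ = 2^28` for `n ≤ 21`. -/
theorem klg6_ppGain_eq_of_le {n : ℕ} (hn : n ≤ 21) (ρ : ℝ) : klEngGeo6.ppGain n ρ = 2 ^ 28 := klg5_ppGain_eq_of_le hn ρ

/-- `gainBar klEngGeo6 … = 3·2^28·(Klam U)²` for `n ≤ 12`. -/
theorem klg6_gainBar_eq_of_le_twelve {n : ℕ} (hn : n ≤ 12) (P : SplitConsts) (U ρpp ρd ρx : ℝ) :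
    gainBar klEngGeo6 P U n ρpp ρd ρx = 3 * 2 ^ 28 * (P.Klam * U) ^ 2 := klg5_gainBar_eq_of_le_twelve hn P U ρpp ρd ρx

/-- `2^28·(Klam U)² ≤ gainBar klEngGeo6 …` for `n ≤ 21` (`ρd, ρx ≥ 0`). -/
theorem klg6_gainBar_ge_of_le {n : ℕ} (hn : n ≤ 21) (P : SplitConsts) (U ρpp : ℝ) {ρd ρx : ℝ} (hd : 0 ≤ ρd) (hx : 0 ≤ ρx) :
    2 ^ 28 * (P.Klam * U) ^ 2 ≤ gainBar klEngGeo6 P U n ρpp ρd ρx := klg5_gainBar_ge_of_le hn P U ρpp hd hx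

/-! ## §3 The thermal slot, the forward-bubble and two-shell shapes, the band, at `klEngGeo6` -/

/-- **Thermal reading at `klEngGeo6`**: `X ≤ C(Klam U)²(π/β)/Λ_n`, `4C ≤ 2^80`, `n ≤ n_β+1` ⇒ `X ≤ thermalBar klEngGeo6 P U β n`. -/
theorem klg6_thermal_reading {P : SplitConsts} {U β X C : ℝ} {n : ℕ} (hC : 0 ≤ C) (hC' : 4 * C ≤ 2 ^ 80) (hβ : klBetaMin ≤ β)
    (hn : n ≤ nScales β + 1) (hX : X ≤ C * (P.Klam * U) ^ 2 * ((Real.pi / β) / klScale klE0 n)) :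
    X ≤ thermalBar klEngGeo6 P U β n :=
  klg5_thermal_reading hC hC' hβ hn hX

/-- The same per unit coupling: `E ≤ C(π/β)/Λ_n` ⇒ `(Klam U)²·E ≤ thermalBar klEngGeo6 P U β n`. -/
theorem klg6_thermal_reading' {P : SplitConsts} {U β E C : ℝ} {n : ℕ} (hC : 0 ≤ C) (hC' : 4 * C ≤ 2 ^ 80) (hβ : klBetaMin ≤ β)
    (hn : n ≤ nScales β + 1) (hE : E ≤ C * ((Real.pi / β) / klScale klE0 n)) :
    (P.Klam * U) ^ 2 * E ≤ thermalBar klEngGeo6 P U β n :=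
  klg5_thermal_reading' hC hC' hβ hn hE

/-- **Forward-bubble shape ⇒ (X)-line BELOW + `thermalBar klEngGeo6`** (= `klg5_below_add_thermal_of_forward`). -/
theorem klg6_below_add_thermal_of_forward {P : SplitConsts} {U β ρ b L_W B_W c₁ c₂ c₃ : ℝ} {n : ℕ} (hK : 1 ≤ P.Klam) (hρ : 0 ≤ ρ)
    (hβ : klBetaMin ≤ β) (hn : n ≤ nScales β + 1)
    (h1 : 0 ≤ c₁ * L_W) (h1' : c₁ * L_W ≤ 2 ^ 57) (h2 : 0 ≤ c₂ * B_W) (h2' : 4 * (c₂ * B_W) ≤ 2 ^ 80) (h3 : 0 ≤ c₃ * B_W)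
    (h3' : c₃ * B_W ≤ 2 ^ 52)
    (hb : b ≤ U ^ 2 * (c₁ * L_W * klScale klE0 n + c₂ * B_W * ((Real.pi / β) / klScale klE0 n) + c₃ * B_W * ρ / klScale klE0 n)) :
    b ≤ (P.Klam * U) ^ 2 * 2 ^ 28 * (2 ^ 24 * ((4 : ℝ) ^ n)⁻¹ + 2 ^ 24 * ρ / klE0 * (4 : ℝ) ^ n) + thermalBar klEngGeo6 P U β n :=
  klg5_below_add_thermal_of_forward hK hρ hβ hn h1 h1' h2 h2' h3 h3' hb

/-- **Band reading at `klEngGeo6`**: `X ≤ C·(Klam U)²`, `0 ≤ C`, `C·4^T ≤ 2^80`, `n_β ≤ n + T` ⇒ `X ≤ thermalBar klEngGeo6 P U β n`. -/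
theorem klg6_band_le_thermalBar {P : SplitConsts} {U β X C : ℝ} {n T : ℕ} (hC : 0 ≤ C) (hCT : C * 4 ^ T ≤ 2 ^ 80)
    (hband : nScales β ≤ n + T) (hX : X ≤ C * (P.Klam * U) ^ 2) : X ≤ thermalBar klEngGeo6 P U β n :=
  klg5_band_le_thermalBar hC hCT hband hX

section Model

variable {L M : ℕ} [NeZero L] [NeZero M] {P : SplitConsts} {Q : EngConsts} {β U μ : ℝ} {K : TrigPolyC4v} {n T : ℕ} {Cp Cq : ℝ}

/-- **The value conjuncts of `stub_engine_step_values` in the thermal band at `(klEngGeo6, Q)` from SIGN-BLIND bounds**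
(= `klg5_band_stepValues_of_signBlind` with `klEngGeo5 ↦ klEngGeo6`; `Q` generic, e.g. `klEngQ6 P R` by `klEngQ6_wf`). -/
theorem klg6_band_stepValues_of_signBlind (hP : P.WF) (hQ : Q.WF) (hn : 1 ≤ n) (hband : nScales β ≤ n + T)
    (hCp : 0 ≤ Cp) (hCpT : Cp * 4 ^ T ≤ 2 ^ 80) (hCq : 0 ≤ Cq) (hCqT : Cq * 4 ^ T ≤ 2 ^ 80)
    (hpair : ∀ Qm : TorusSite 2 L, ∀ k ∈ klBall L μ K, ∀ k' ∈ klBall L μ K,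
      ‖klPairAmplitude L M β U μ K n Qm k k' - klPairAmplitude L M β U μ K (n - 1) Qm k k'‖ ≤ Cp * (P.Klam * U) ^ 2)
    (hquart : ∀ k₁ ∈ klBall L μ K, ∀ k₂ ∈ klBall L μ K, ∀ k₃ ∈ klBall L μ K,
      ‖klQuarticValue L M β U μ K n 0 1 k₁ k₂ k₃ - klQuarticValue L M β U μ K (n - 1) 0 1 k₁ k₂ k₃‖ ≤ Cq * (P.Klam * U) ^ 2)
    (hE4 : EngineFirstMoments L M klEngGeo6 P Q β U μ K n) (hE5 : IsoTupleL1AtS L M klEngGeo6 P β U μ K n) :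
    PairLadderStepAtV10 L M klEngGeo6 P Q β U μ K n ∧ PairValueIncrementAtV7 L M klEngGeo6 P Q β U μ K n ∧
      QuarticValueIncrementAtS4 L M klEngGeo6 P Q β U μ K n ∧ EngineFirstMoments L M klEngGeo6 P Q β U μ K n ∧
        IsoTupleL1AtS L M klEngGeo6 P β U μ K n := by
  have h3 := klband_valueClauses_of_le_thermalBar (G := klEngGeo6) klEngGeo6_wf hP hQ hn
    (fun Qm k hk k' hk' => klg6_band_le_thermalBar hCp hCpT hband (hpair Qm k hk k' hk'))
    (fun k₁ hk₁ k₂ hk₂ k₃ hk₃ => klg6_band_le_thermalBar hCq hCqT hband (hquart k₁ hk₁ k₂ hk₂ k₃ hk₃))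
  exact ⟨h3.1, h3.2.1, h3.2.2, hE4, hE5⟩

end Model

end Summit.HubbardSuperconductivity.HubbardSuperconductivity.Theorems.EngineV8

end
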